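import Summits.CriticalPhenomena.PercolationContinuityZ3.Theorems.PercNearOneGluingNoHeavyLowerTailSahiTangentCylinderFourPoly
import Summits.CriticalPhenomena.PercolationContinuityZ3.Theorems.PercNearOneGluingNoHeavyLowerTailSahiTangentDisjointSlot
import Literature.Combinatorics.Sahi2008.ProvedCases
import Literature.Combinatorics.Sahi2008.Percolation

/-!
# `NoHeavyLowerTail` (crux stmt-CriticalPhenomena-4575), Sahi programme: **THE ORDER-4 VERTEX (CONTRACTION) INEQUALITY HOLDS FOR ARBITRARY
# INCREASING EVENTS UNDER EVERY FKG MEASURE** — `E_4^{B_s⊗ν}(ε·1_{U_0},…,ε·1_{U_3}) ≥ s·E_4^{ν}(1_{U_0},…,1_{U_3})` for ANY four up-sets `U_l` of a finite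
# distributive lattice and ANY FKG weight `ν`; hence `A_4(X) ≥ 0` ("four arbitrary up-sets", census W172 / gen-49 memo §5(c)) in complete generality

Support file (Sahi cell, seat `prim-sahi-p1`, generation 50; `--supports stmt-CriticalPhenomena-4575`).  Pure proofs, NO definitions, no `sorry`,
standard axioms.

OBSERVATION (gen 50).  The vertex polynomials of gen 49's order-4 file (`vertexQ_empty`, `vertexQ_triple_012`, `vertexQ_pair_01`, …,
`…SahiTangentCylinderFourPoly`) are proved from NOTHING BUT nonnegativity and HARRIS-TYPE products `X_S·X_T ≤ X_{S∪T}` of the joint masses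
`X_S = ν(⋂_{l∈S} U_l)` — no product structure, no cylinder shape.  These hypotheses hold for ARBITRARY up-sets `U_l` under ANY FKG weight (FKG for
two up-sets, `fkg_upperSet_mass`).  Consequently the order-4 VERTEX INEQUALITY `E_4^{B_s⊗ν}(F^L) ≥ s·E_4^{ν}(tops)` (slots in `L` top-only:
`ε·1_{U_l}`; the others plain: `1_{U_l}`) holds for arbitrary up-sets on every FKG lattice, for every `L` with `|L| ≥ 2` (for `|L| = 1` it is an
equality, `SahiTangent.sahiE_coin_top`; `L = ∅` is Sahi positivity itself and is NOT claimed).  This file proves the three canonical shapes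
`L = {0,1,2,3}`, `{0,1,2}`, `{0,1}` (the others are relabellings), via the exact identities
`E_4(M^L) − s·E_4(X) = s(1−s)·Q_L(X;s)` (`M^L_S = s·X_S` if `S ∩ L ≠ ∅`, else `X_S`; checked by `ring`) and gen 49's `Q_L ≥ 0`.
READINGS.  (i) `L = [4]`: for increasing events `A_0,…,A_3` and an INDEPENDENT event `P` (the coin): `E_4(A_0∩P,…,A_3∩P) ≥ μ(P)·E_4(A_0,…,A_3)`;
the tangent at `s = 1` is `A_4(X) := Σ_π c_π(1−|π|)Π X_B = 2Σ_aX_aX_{bcd} + Σ X_{ab}X_{cd} + 3X_0X_1X_2X_3 − 2Σ X_{ab}X_cX_d ≥ 0` for four ARBITRARY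
up-sets under ANY FKG measure (`A4_nonneg_of_fkg`) — census W172 certified this coefficientwise for product measures on cubes of dimension ≤ 4;
here it is a two-line consequence of `vertexQ_empty` at `s = 1`, in every dimension and for every FKG weight.  (ii) Conjecture T_4 (memo
FROM-prim-sahi-p2-gen32-TANGENT) holds at every VERTEX (bottom section = top section or empty) for arbitrary increasing events and FKG measures; what
fails for general pairs (W161) is only the interpolation between vertices.  Order 3 is included for completeness (`sahiE_three_coin_topOnly_ge`, Harris only).
Nothing conjectural is asserted. [this work]
-/

namespace Summit.CriticalPhenomena.PercolationContinuityZ3.Theorems.SahiTangent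

open Finset Function Literature.Combinatorics.Sahi2008
open Literature.Probability.LatticeModels (mass mass_nonneg mass_univ fkg_upperSet_mass)
open scoped BigOperators

noncomputable section

variable {α : Type*} [DistribLattice α] [Fintype α] [DecidableEq α]

/-! ### Slot calculus on `Bool × α` -/

omit [DistribLattice α] [Fintype α] in
/-- Product of two top-only slots. [this work] -/
theorem topOnly_mul (A B : Finset α) :
    ((fun z : Bool × α => if z.1 then setInd A z.2 else 0) * fun z : Bool × α => if z.1 then setInd B z.2 else 0)
      = fun z : Bool × α => if z.1 then setInd (A ∩ B) z.2 else 0 := by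
  funext z; rcases z with ⟨e, x⟩
  cases e
  · simp
  · simp only [Pi.mul_apply, if_true, ← setInd_mul]

omit [DistribLattice α] [Fintype α] in
/-- Product of a top-only slot and a plain slot. [this work] -/
theorem topOnly_mul_plain (A B : Finset α) :
    ((fun z : Bool × α => if z.1 then setInd A z.2 else 0) * fun z : Bool × α => setInd B z.2)
      = fun z : Bool × α => if z.1 then setInd (A ∩ B) z.2 else 0 := by
  funext z; rcases z with ⟨e, x⟩
  cases e
  · simp
  · simp only [Pi.mul_apply, if_true, ← setInd_mul]

omit [DistribLattice α] [Fintype α] in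
/-- Product of a plain slot and a top-only slot. [this work] -/
theorem plain_mul_topOnly (A B : Finset α) :
    ((fun z : Bool × α => setInd A z.2) * fun z : Bool × α => if z.1 then setInd B z.2 else 0)
      = fun z : Bool × α => if z.1 then setInd (A ∩ B) z.2 else 0 := by
  funext z; rcases z with ⟨e, x⟩
  cases e
  · simp
  · simp only [Pi.mul_apply, if_true, ← setInd_mul]

omit [DistribLattice α] [Fintype α] in
/-- Product of two plain slots. [this work] -/
theorem plain_mul_plain (A B : Finset α) :
    ((fun z : Bool × α => setInd A z.2) * fun z : Bool × α => setInd B z.2) = fun z : Bool × α => setInd (A ∩ B) z.2 := by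
  funext z; simp only [Pi.mul_apply, ← setInd_mul]

omit [DistribLattice α] in
/-- Expectation of a top-only slot under `B_s ⊗ ν`. [this work] -/
theorem ex_coin_topOnly (ν : α → ℝ) (s : ℝ) (A : Finset α) :
    ex (fun z : Bool × α => if z.1 then s * ν z.2 else (1 - s) * ν z.2) (fun z => if z.1 then setInd A z.2 else 0) = s * mass ν A := by
  rw [ex_coin_top ν s (setInd A), ex_setInd]

omit [DistribLattice α] in
/-- Expectation of a plain slot under `B_s ⊗ ν`. [this work] -/
theorem ex_coin_plain (ν : α → ℝ) (s : ℝ) (A : Finset α) :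
    ex (fun z : Bool × α => if z.1 then s * ν z.2 else (1 - s) * ν z.2) (fun z => setInd A z.2) = mass ν A := by
  rw [ex_coin_snd ν s (setInd A), ex_setInd]

/-- Harris for two up-sets under an FKG probability weight, mass form. [this work] -/
theorem harris_mass {ν : α → ℝ} (hν : IsFKGMeasure ν) {A B : Finset α} (hA : IsUpperSet (A : Set α)) (hB : IsUpperSet (B : Set α)) :
    mass ν A * mass ν B ≤ mass ν (A ∩ B) := by
  have h := fkg_upperSet_mass (μ := ν) (fun x => hν.nonneg x) hν.mul_le_mul hA hB
  rw [mass_univ, hν.sum_eq_one, one_mul] at h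
  exact h

omit [DistribLattice α] [Fintype α] in
/-- Intersections of up-sets are up-sets (Finset form). [folklore] -/
theorem isUpperSet_inter' {A B : Finset α} [Preorder α] (hA : IsUpperSet (A : Set α)) (hB : IsUpperSet (B : Set α)) :
    IsUpperSet ((A ∩ B : Finset α) : Set α) := by
  rw [Finset.coe_inter]; exact hA.inter hB

/-! ### Order 3 (Harris only) -/

/-- **Order 3**: `E_3^{B_s⊗ν}(ε·1_{U_0}, ε·1_{U_1}, ε·1_{U_2}) ≥ s·E_3^{ν}(1_{U_0},1_{U_1},1_{U_2})` for arbitrary up-sets under any FKG weight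
(`= s(1−s)[Σ_a X_aX_{bc} − (1+s)X_0X_1X_2] ≥ 0` by Harris). [this work] -/
theorem sahiE_three_coin_topOnly_ge {ν : α → ℝ} (hν : IsFKGMeasure ν) {s : ℝ} (hs0 : 0 ≤ s) (hs1 : s ≤ 1) (U : Fin 3 → Finset α)
    (hU : ∀ l, IsUpperSet (U l : Set α)) :
    s * sahiE ν 3 (fun l => setInd (U l)) ≤
      sahiE (fun z : Bool × α => if z.1 then s * ν z.2 else (1 - s) * ν z.2) 3 (fun l (z : Bool × α) => if z.1 then setInd (U l) z.2 else 0) := by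
  have e1 : (fun l => setInd (U l)) = ![setInd (U 0), setInd (U 1), setInd (U 2)] := by
    funext l; fin_cases l <;> rfl
  have e2 : (fun l (z : Bool × α) => if z.1 then setInd (U l) z.2 else 0)
      = ![fun z : Bool × α => if z.1 then setInd (U 0) z.2 else 0, fun z : Bool × α => if z.1 then setInd (U 1) z.2 else 0,
          fun z : Bool × α => if z.1 then setInd (U 2) z.2 else 0] := by
    funext l; fin_cases l <;> rfl
  rw [e1, e2, sahiE_three, sahiE_three]
  simp only [topOnly_mul, ex_coin_topOnly, setInd_mul, ex_setInd]
  have n0 := mass_nonneg (μ := ν) (fun x => hν.nonneg x) (U 0)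
  have n1 := mass_nonneg (μ := ν) (fun x => hν.nonneg x) (U 1)
  have n2 := mass_nonneg (μ := ν) (fun x => hν.nonneg x) (U 2)
  have h12 := harris_mass hν (hU 1) (hU 2)
  have h02 := harris_mass hν (hU 0) (hU 2)
  have h01 := harris_mass hν (hU 0) (hU 1)
  have h1s : 0 ≤ 1 - s := sub_nonneg.2 hs1
  have hP : 0 ≤ mass ν (U 0) * mass ν (U 1) * mass ν (U 2) := mul_nonneg (mul_nonneg n0 n1) n2
  nlinarith [mul_nonneg (mul_nonneg hs0 h1s) (mul_nonneg n0 (sub_nonneg.2 h12)), mul_nonneg (mul_nonneg hs0 h1s) (mul_nonneg n1 (sub_nonneg.2 h02)),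
    mul_nonneg (mul_nonneg hs0 h1s) (mul_nonneg n2 (sub_nonneg.2 h01)), mul_nonneg (mul_nonneg hs0 h1s) hP,
    mul_nonneg (mul_nonneg hs0 h1s) (mul_nonneg h1s hP)]

/-! ### Order 4: the three canonical vertex shapes -/

/-- The fifteen joint masses of four up-sets and their Harris inequalities (bookkeeping for the three theorems below). [this work] -/
theorem harris15 {ν : α → ℝ} (hν : IsFKGMeasure ν) (U : Fin 4 → Finset α) (hU : ∀ l, IsUpperSet (U l : Set α)) :
    0 ≤ mass ν (U 0) ∧ 0 ≤ mass ν (U 1) ∧ 0 ≤ mass ν (U 2) ∧ 0 ≤ mass ν (U 3) ∧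
    0 ≤ mass ν (U 0 ∩ U 1) ∧ 0 ≤ mass ν (U 0 ∩ U 2) ∧ 0 ≤ mass ν (U 0 ∩ U 3) ∧ 0 ≤ mass ν (U 1 ∩ U 2) ∧ 0 ≤ mass ν (U 1 ∩ U 3) ∧
    0 ≤ mass ν (U 2 ∩ U 3) ∧ 0 ≤ mass ν (U 0 ∩ U 1 ∩ U 2) ∧ 0 ≤ mass ν (U 0 ∩ U 1 ∩ U 3) ∧ 0 ≤ mass ν (U 0 ∩ U 2 ∩ U 3) ∧
    mass ν (U 0) * mass ν (U 1) ≤ mass ν (U 0 ∩ U 1) ∧ mass ν (U 0 ∩ U 2) * mass ν (U 1) ≤ mass ν (U 0 ∩ U 1 ∩ U 2) ∧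
    mass ν (U 0) * mass ν (U 1 ∩ U 2) ≤ mass ν (U 0 ∩ U 1 ∩ U 2) ∧ mass ν (U 0 ∩ U 1) * mass ν (U 3) ≤ mass ν (U 0 ∩ U 1 ∩ U 3) ∧
    mass ν (U 0) * mass ν (U 1 ∩ U 3) ≤ mass ν (U 0 ∩ U 1 ∩ U 3) ∧ mass ν (U 0) * mass ν (U 2) ≤ mass ν (U 0 ∩ U 2) ∧
    mass ν (U 0 ∩ U 2) * mass ν (U 3) ≤ mass ν (U 0 ∩ U 2 ∩ U 3) ∧ mass ν (U 0 ∩ U 3) * mass ν (U 2) ≤ mass ν (U 0 ∩ U 2 ∩ U 3) ∧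
    mass ν (U 0) * mass ν (U 3) ≤ mass ν (U 0 ∩ U 3) ∧ mass ν (U 1) * mass ν (U 2) ≤ mass ν (U 1 ∩ U 2) ∧
    mass ν (U 1 ∩ U 2) * mass ν (U 3) ≤ mass ν (U 1 ∩ U 2 ∩ U 3) ∧ mass ν (U 1 ∩ U 3) * mass ν (U 2) ≤ mass ν (U 1 ∩ U 2 ∩ U 3) ∧
    mass ν (U 1) * mass ν (U 2 ∩ U 3) ≤ mass ν (U 1 ∩ U 2 ∩ U 3) ∧ mass ν (U 1) * mass ν (U 3) ≤ mass ν (U 1 ∩ U 3) ∧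
    mass ν (U 2) * mass ν (U 3) ≤ mass ν (U 2 ∩ U 3) ∧ mass ν (U 0 ∩ U 1) * mass ν (U 2) ≤ mass ν (U 0 ∩ U 1 ∩ U 2) ∧
    mass ν (U 0 ∩ U 3) * mass ν (U 1) ≤ mass ν (U 0 ∩ U 1 ∩ U 3) ∧ mass ν (U 0) * mass ν (U 2 ∩ U 3) ≤ mass ν (U 0 ∩ U 2 ∩ U 3) := by
  have n := fun A => mass_nonneg (μ := ν) (fun x => hν.nonneg x) A
  have i := fun {A B : Finset α} (hA : IsUpperSet (A : Set α)) (hB : IsUpperSet (B : Set α)) => isUpperSet_inter' hA hB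
  have h := fun {A B : Finset α} (hA : IsUpperSet (A : Set α)) (hB : IsUpperSet (B : Set α)) => harris_mass hν hA hB
  -- set identities for the reordered intersections
  have e021 : U 0 ∩ U 2 ∩ U 1 = U 0 ∩ U 1 ∩ U 2 := by ext x; simp only [Finset.mem_inter]; tauto
  have e0_12 : U 0 ∩ (U 1 ∩ U 2) = U 0 ∩ U 1 ∩ U 2 := by ext x; simp only [Finset.mem_inter]; tauto
  have e0_13 : U 0 ∩ (U 1 ∩ U 3) = U 0 ∩ U 1 ∩ U 3 := by ext x; simp only [Finset.mem_inter]; tauto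
  have e032 : U 0 ∩ U 3 ∩ U 2 = U 0 ∩ U 2 ∩ U 3 := by ext x; simp only [Finset.mem_inter]; tauto
  have e132 : U 1 ∩ U 3 ∩ U 2 = U 1 ∩ U 2 ∩ U 3 := by ext x; simp only [Finset.mem_inter]; tauto
  have e1_23 : U 1 ∩ (U 2 ∩ U 3) = U 1 ∩ U 2 ∩ U 3 := by ext x; simp only [Finset.mem_inter]; tauto
  have e031 : U 0 ∩ U 3 ∩ U 1 = U 0 ∩ U 1 ∩ U 3 := by ext x; simp only [Finset.mem_inter]; tauto
  have e0_23 : U 0 ∩ (U 2 ∩ U 3) = U 0 ∩ U 2 ∩ U 3 := by ext x; simp only [Finset.mem_inter]; tauto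
  refine ⟨n _, n _, n _, n _, n _, n _, n _, n _, n _, n _, n _, n _, n _, h (hU 0) (hU 1), ?_, ?_, h (i (hU 0) (hU 1)) (hU 3), ?_, h (hU 0) (hU 2),
    h (i (hU 0) (hU 2)) (hU 3), ?_, h (hU 0) (hU 3), h (hU 1) (hU 2), h (i (hU 1) (hU 2)) (hU 3), ?_, ?_, h (hU 1) (hU 3), h (hU 2) (hU 3),
    h (i (hU 0) (hU 1)) (hU 2), ?_, ?_⟩
  · have := h (i (hU 0) (hU 2)) (hU 1); rwa [e021] at this
  · have := h (hU 0) (i (hU 1) (hU 2)); rwa [e0_12] at this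
  · have := h (hU 0) (i (hU 1) (hU 3)); rwa [e0_13] at this
  · have := h (i (hU 0) (hU 3)) (hU 2); rwa [e032] at this
  · have := h (i (hU 1) (hU 3)) (hU 2); rwa [e132] at this
  · have := h (hU 1) (i (hU 2) (hU 3)); rwa [e1_23] at this
  · have := h (i (hU 0) (hU 3)) (hU 1); rwa [e031] at this
  · have := h (hU 0) (i (hU 2) (hU 3)); rwa [e0_23] at this

/-- **ORDER-4 VERTEX INEQUALITY, ALL FOUR SLOTS TOP-ONLY, arbitrary up-sets, any FKG weight**:
`s·E_4^{ν}(1_{U_0},…,1_{U_3}) ≤ E_4^{B_s⊗ν}(ε·1_{U_0},…,ε·1_{U_3})` — for increasing events and an independent event `P`,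
`E_4(A_0∩P,…,A_3∩P) ≥ μ(P)·E_4(A_0,…,A_3)`. [this work] -/
theorem sahiE_four_coin_topOnly_ge {ν : α → ℝ} (hν : IsFKGMeasure ν) {s : ℝ} (hs0 : 0 ≤ s) (hs1 : s ≤ 1) (U : Fin 4 → Finset α)
    (hU : ∀ l, IsUpperSet (U l : Set α)) :
    s * sahiE ν 4 (fun l => setInd (U l)) ≤
      sahiE (fun z : Bool × α => if z.1 then s * ν z.2 else (1 - s) * ν z.2) 4 (fun l (z : Bool × α) => if z.1 then setInd (U l) z.2 else 0) := by
  have e1 : (fun l => setInd (U l)) = ![setInd (U 0), setInd (U 1), setInd (U 2), setInd (U 3)] := by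
    funext l; fin_cases l <;> rfl
  have e2 : (fun l (z : Bool × α) => if z.1 then setInd (U l) z.2 else 0)
      = ![fun z : Bool × α => if z.1 then setInd (U 0) z.2 else 0, fun z : Bool × α => if z.1 then setInd (U 1) z.2 else 0,
          fun z : Bool × α => if z.1 then setInd (U 2) z.2 else 0, fun z : Bool × α => if z.1 then setInd (U 3) z.2 else 0] := by
    funext l; fin_cases l <;> rfl
  rw [e1, e2, sahiE_four, sahiE_four]
  simp only [topOnly_mul, ex_coin_topOnly, setInd_mul, ex_setInd]
  obtain ⟨n0, n1, n2, n3, n01, n02, n03, n12, n13, n23, n012, n013, n023, h_0_1, h_02_1, h_0_12, h_01_3, h_0_13, h_0_2, h_02_3, h_03_2, h_0_3,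
    h_1_2, h_12_3, h_13_2, h_1_23, h_1_3, h_2_3, h_01_2, h_03_1, h_0_23⟩ := harris15 hν U hU
  have hV := SahiTangentCyl.vertexQ_empty (s := s) hs0 hs1 n0 n1 n2 n3 n01 n03 n12 n13 n012 n013 h_0_1 h_02_1 h_0_12 h_01_3 h_0_13 h_0_2 h_02_3
    h_03_2 h_0_3 h_1_2 h_12_3 h_13_2 h_1_23 h_1_3 h_2_3
  have h1s : 0 ≤ 1 - s := sub_nonneg.2 hs1
  nlinarith [mul_nonneg (mul_nonneg hs0 h1s) hV]

/-- **`A_4 ≥ 0` FOR FOUR ARBITRARY UP-SETS UNDER ANY FKG WEIGHT** (the tangent of the previous theorem at `s = 1`; `X_S = ν(⋂_{l∈S} U_l)`):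
`2Σ_aX_aX_{bcd} + Σ_{matchings}X_{ab}X_{cd} + 3X_0X_1X_2X_3 − 2Σ_{pairs}X_{ab}X_cX_d ≥ 0`. [this work] -/
theorem A4_nonneg_of_fkg {ν : α → ℝ} (hν : IsFKGMeasure ν) (U : Fin 4 → Finset α) (hU : ∀ l, IsUpperSet (U l : Set α)) :
    0 ≤ 2 * (mass ν (U 0) * mass ν (U 1 ∩ U 2 ∩ U 3) + mass ν (U 1) * mass ν (U 0 ∩ U 2 ∩ U 3) + mass ν (U 2) * mass ν (U 0 ∩ U 1 ∩ U 3)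
        + mass ν (U 3) * mass ν (U 0 ∩ U 1 ∩ U 2))
      + (mass ν (U 0 ∩ U 1) * mass ν (U 2 ∩ U 3) + mass ν (U 0 ∩ U 2) * mass ν (U 1 ∩ U 3) + mass ν (U 0 ∩ U 3) * mass ν (U 1 ∩ U 2))
      + 3 * (mass ν (U 0) * mass ν (U 1) * mass ν (U 2) * mass ν (U 3))
      - 2 * (mass ν (U 0 ∩ U 1) * mass ν (U 2) * mass ν (U 3) + mass ν (U 0 ∩ U 2) * mass ν (U 1) * mass ν (U 3)
        + mass ν (U 0 ∩ U 3) * mass ν (U 1) * mass ν (U 2) + mass ν (U 1 ∩ U 2) * mass ν (U 0) * mass ν (U 3)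
        + mass ν (U 1 ∩ U 3) * mass ν (U 0) * mass ν (U 2) + mass ν (U 2 ∩ U 3) * mass ν (U 0) * mass ν (U 1)) := by
  obtain ⟨n0, n1, n2, n3, n01, n02, n03, n12, n13, n23, n012, n013, n023, h_0_1, h_02_1, h_0_12, h_01_3, h_0_13, h_0_2, h_02_3, h_03_2, h_0_3,
    h_1_2, h_12_3, h_13_2, h_1_23, h_1_3, h_2_3, h_01_2, h_03_1, h_0_23⟩ := harris15 hν U hU
  have hV := SahiTangentCyl.vertexQ_empty (s := (1 : ℝ)) zero_le_one le_rfl n0 n1 n2 n3 n01 n03 n12 n13 n012 n013 h_0_1 h_02_1 h_0_12 h_01_3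
    h_0_13 h_0_2 h_02_3 h_03_2 h_0_3 h_1_2 h_12_3 h_13_2 h_1_23 h_1_3 h_2_3
  linarith

/-- **ORDER-4 VERTEX INEQUALITY, three top-only slots** (`0,1,2` top-only, `3` plain), arbitrary up-sets, any FKG weight. [this work] -/
theorem sahiE_four_coin_vertex3_ge {ν : α → ℝ} (hν : IsFKGMeasure ν) {s : ℝ} (hs0 : 0 ≤ s) (hs1 : s ≤ 1) (U : Fin 4 → Finset α)
    (hU : ∀ l, IsUpperSet (U l : Set α)) :
    s * sahiE ν 4 (fun l => setInd (U l)) ≤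
      sahiE (fun z : Bool × α => if z.1 then s * ν z.2 else (1 - s) * ν z.2) 4
        ![fun z : Bool × α => if z.1 then setInd (U 0) z.2 else 0, fun z : Bool × α => if z.1 then setInd (U 1) z.2 else 0,
          fun z : Bool × α => if z.1 then setInd (U 2) z.2 else 0, fun z : Bool × α => setInd (U 3) z.2] := by
  have e1 : (fun l => setInd (U l)) = ![setInd (U 0), setInd (U 1), setInd (U 2), setInd (U 3)] := by
    funext l; fin_cases l <;> rfl
  rw [e1, sahiE_four, sahiE_four]
  simp only [topOnly_mul, topOnly_mul_plain, ex_coin_topOnly, ex_coin_plain, setInd_mul, ex_setInd]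
  obtain ⟨n0, n1, n2, n3, n01, n02, n03, n12, n13, n23, n012, n013, n023, h_0_1, h_02_1, h_0_12, h_01_3, h_0_13, h_0_2, h_02_3, h_03_2, h_0_3,
    h_1_2, h_12_3, h_13_2, h_1_23, h_1_3, h_2_3, h_01_2, h_03_1, h_0_23⟩ := harris15 hν U hU
  have hV := SahiTangentCyl.vertexQ_triple_012 (s := s) hs0 hs1 n0 n1 n2 n3 n01 n03 n12 n13 n013 h_03_1 h_0_13 h_0_2 h_02_3 h_03_2 h_0_23 h_1_2
    h_12_3 h_1_23 h_2_3
  have h1s : 0 ≤ 1 - s := sub_nonneg.2 hs1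
  nlinarith [mul_nonneg (mul_nonneg hs0 h1s) hV]

/-- **ORDER-4 VERTEX INEQUALITY, two top-only slots** (`0,1` top-only, `2,3` plain), arbitrary up-sets, any FKG weight. [this work] -/
theorem sahiE_four_coin_vertex2_ge {ν : α → ℝ} (hν : IsFKGMeasure ν) {s : ℝ} (hs0 : 0 ≤ s) (hs1 : s ≤ 1) (U : Fin 4 → Finset α)
    (hU : ∀ l, IsUpperSet (U l : Set α)) :
    s * sahiE ν 4 (fun l => setInd (U l)) ≤
      sahiE (fun z : Bool × α => if z.1 then s * ν z.2 else (1 - s) * ν z.2) 4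
        ![fun z : Bool × α => if z.1 then setInd (U 0) z.2 else 0, fun z : Bool × α => if z.1 then setInd (U 1) z.2 else 0,
          fun z : Bool × α => setInd (U 2) z.2, fun z : Bool × α => setInd (U 3) z.2] := by
  have e1 : (fun l => setInd (U l)) = ![setInd (U 0), setInd (U 1), setInd (U 2), setInd (U 3)] := by
    funext l; fin_cases l <;> rfl
  rw [e1, sahiE_four, sahiE_four]
  simp only [topOnly_mul, topOnly_mul_plain, plain_mul_plain, ex_coin_topOnly, ex_coin_plain, setInd_mul, ex_setInd]
  obtain ⟨n0, n1, n2, n3, n01, n02, n03, n12, n13, n23, n012, n013, n023, h_0_1, h_02_1, h_0_12, h_01_3, h_0_13, h_0_2, h_02_3, h_03_2, h_0_3,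
    h_1_2, h_12_3, h_13_2, h_1_23, h_1_3, h_2_3, h_01_2, h_03_1, h_0_23⟩ := harris15 hν U hU
  have hV := SahiTangentCyl.vertexQ_pair_01 n0 n1 n2 n3 n03 n12 n13 h_0_2 h_02_3 h_03_2 h_12_3 h_1_23
  have h1s : 0 ≤ 1 - s := sub_nonneg.2 hs1
  nlinarith [mul_nonneg (mul_nonneg hs0 h1s) hV]

end

end Summit.CriticalPhenomena.PercolationContinuityZ3.Theorems.SahiTangent
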